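import Summits.QuantumFields.QCD.Theorems.SpectralDefectExtinctionTipPricingInertiaGluing
import Summits.QuantumFields.QCD.Theorems.SpectralDefectExtinctionTipPricingInertiaHaynsworth

/-!
# The abstract modular template theorem (pure linear algebra)

Composition of Haynsworth inertia additivity (`negRootCount_fromBlocks_haynsworth`, p108278) with inertia gluing
(`negRootCount_eq_sum_of_blocks`, p107414): for a Hermitian block matrix `H = [[Hc, B],[Bᴴ, Hw]]` (cells ⊕ wall) whose wall
block `Hw` is invertible, if the Schur complement `Hc − B Hw⁻¹ Bᴴ`, read on `n × o` (cell index × cell label), differs from a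
block-diagonal `⊕_k K_k` of gapped Hermitian cell operators by a sub-gap Hermitian form, then
`n₋(H) = n₋(Hw) + Σ_k n₋(K_k)` and `det H ≠ 0`.  This is what the tiling bookkeeping of `stub_spreadOfCells` feeds
(wall inertia `n₋(Hw) = half_wall` from `wallBlock_gap_and_half_of_hop`, cell data `n₋(K_k) ≥ half_cell + e` and the gap from
`CellLemma` via `norm_gap_schur_complement`, the sub-gap error from `wallBlock_inv_decay`).  Lead c2; serves `stub_spreadOfCells`
of line `hermitian-flow-coarea` r3 for crux `TipPricing` (stmt-QuantumFields-8967).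
-/

namespace Summit.QuantumFields.QCD.Cruxes.TipPricing.ModularTemplate

open Matrix
open Summit.QuantumFields.QCD.Theorems.ExtinctionBuildsQCD.Negative
open scoped BigOperators

/-- **Abstract modular template.**  `Hw` invertible Hermitian wall block, `Hc` Hermitian, `B` the coupling; `K : o → Matrix n n ℂ`
gapped Hermitian cell operators (`g²‖w‖² ≤ ‖K_k w‖²`); if the Schur complement `Hc − B Hw⁻¹ Bᴴ` (cells indexed by `n × o`)
differs from `blockDiagonal K` by a Hermitian form bounded by `δ < g`, then
`n₋([[Hc, B],[Bᴴ, Hw]]) = n₋(Hw) + Σ_k n₋(K_k)` and the block matrix is invertible. [folklore] -/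
theorem negRootCount_cellWall_template {n o w : Type*} [Fintype n] [DecidableEq n] [Fintype o] [DecidableEq o]
    [Fintype w] [DecidableEq w]
    (Hc : Matrix (n × o) (n × o) ℂ) (B : Matrix (n × o) w ℂ) (Hw : Matrix w w ℂ)
    (hHc : Hc.IsHermitian) (hHw : Hw.IsHermitian) (hwdet : Hw.det ≠ 0)
    (K : o → Matrix n n ℂ) (hK : ∀ k, (K k).IsHermitian) {δ g : ℝ} (hδ : 0 ≤ δ) (hδg : δ < g)
    (hgap : ∀ (k : o) (v : n → ℂ), g ^ 2 * ∑ i, ‖v i‖ ^ 2 ≤ ∑ i, ‖(K k *ᵥ v) i‖ ^ 2)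
    (hE : ∀ v : n × o → ℂ,
      |(star v ⬝ᵥ ((Hc - B * Hw⁻¹ * Bᴴ) - blockDiagonal K) *ᵥ v).re| ≤ δ * ∑ x, ‖v x‖ ^ 2) :
    negRootCount (Matrix.fromBlocks Hc B Bᴴ Hw) = negRootCount Hw + ∑ k, negRootCount (K k) ∧
      (Matrix.fromBlocks Hc B Bᴴ Hw).det ≠ 0 := by
  have hS : (Hc - B * Hw⁻¹ * Bᴴ).IsHermitian := by
    have h1 : (B * Hw⁻¹ * Bᴴ).IsHermitian := by
      have := Matrix.isHermitian_mul_mul_conjTranspose B hHw.inv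
      simpa [Matrix.mul_assoc] using this
    exact hHc.sub h1
  obtain ⟨hcount, hSdet⟩ := negRootCount_eq_sum_of_blocks hK hS hδ hδg hgap hE
  refine ⟨?_, ?_⟩
  · rw [negRootCount_fromBlocks_haynsworth Hc B Hw hHc hHw hwdet, hcount]
  · haveI : Invertible Hw.det := invertibleOfNonzero hwdet
    haveI : Invertible Hw := Matrix.invertibleOfDetInvertible Hw
    rw [Matrix.det_fromBlocks₂₂, Matrix.invOf_eq_nonsing_inv]
    exact mul_ne_zero hwdet hSdet

end Summit.QuantumFields.QCD.Cruxes.TipPricing.ModularTemplate
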